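import Literature.AlgebraicGeometry.HodgeTheory.DiagonalCharacterEigenspace
import Literature.AlgebraicGeometry.HodgeTheory.HodgeTypePullbackVanishing
import Literature.AlgebraicGeometry.HodgeTheory.HodgeConjectureQbarVoisinProofs
import HarnessLib

/-!
# Diagonal symmetries preserve algebraic classes and Hodge types; so do the isotypic projectors

Family `hodge`, layer `Literature/AlgebraicGeometry/HodgeTheory`. Brick of the middle-degree case of
the named fact `hodgeClasses_algebraic_fermat` (file `FermatHodgeConjecture`; Shioda, Proc. Japan Acad.
55A (1979) §4: "`G` acts on `Xⁿₘ` … the decomposition `Hⁿ = ⊕ V(α)` is compatible with the Hodge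
decomposition and with the subspace of algebraic classes", Ran, Compositio Math. 42 (1980) §1), for
the diagonal symmetries `g_a : [z] ↦ [a • z]` of a hypersurface `X_F = V₊(F) ⊂ ℙⁿ⁺¹_ℂ`
(`DiagonalSymmetry`: `diagonalAut F ha`, `diagonalMap F ha`; `DiagonalCharacterEigenspace`:
`eigenProjector`, `diagonalCharacterEigenspace`). Everything is PROVED:

* `diagonalProjMap_left_mul`, `diagonalProjMap_left_one`, `diagonalAut_left_mul`,
  `diagonalAut_left_one`, `diagonalAutIso`: the `g_a` form a GROUP of algebraic automorphisms of
  `X_F` (Mathlib `Proj.map_comp`, `Proj.map_id`; the closed immersion `X_F ↪ ℙⁿ⁺¹` is a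
  monomorphism), in particular each `g_a` is an isomorphism of schemes, hence flat;
* `map_diagonalMap_mem_algebraicClasses`, `eigenProjector_mem_algebraicClasses` — **`g_a^*` and
  `π_χ` preserve `algebraicClasses X_F p = Nᵖ H²ᵖ`** (flat pull-back respects the support
  filtration, the tree's `map_mem_algebraicClasses_of_flat`), for `X_F` smooth projective;
* `HodgeModel.pullback_map_mem_hodgePQ_of_endomorphism` — **an endomorphism `g : X ⟶ X` of a
  smooth projective `X` preserves the `(p,q)`-classes of EVERY FIXED Hodge model `A` of `X`**:
  `A.pullback (g^* c) = (g^an)^* A.pullback c = (g^an)^* e(w) = e((g^an)^*_dR w)` by NATURALITY of the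
  comparison family `e = A.deRham` along the holomorphic self-map `g^an` of `A.carrier`
  (`HodgeModel.anMap A A g`), and `(g^an)^*_dR` preserves `H^{p,q}_dR` (`map_mem_hodgePQ`, Voisin I
  §7.3.2). No rigidity of de Rham comparisons (`hodgePQ_independent_of_hodgeModel`) is needed,
  because source and target model coincide; hence `HodgeModel.pullback_diagonalMap_mem_hodgePQ`,
  `HodgeModel.pullback_eigenProjector_mem_hodgePQ` (same model) and the `∃`-model forms
  `IsOfHodgeType.diagonalMap`, `IsOfHodgeType.eigenProjector`;
* `diagonalCharacterEigenspace_le_of_finrank_le_one` — if `dim V_χ ≤ 1` and some class of a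
  `π_χ`-stable subspace `S` (e.g. `algebraicClasses`) has `π_χ c ≠ 0`, then `V_χ ≤ S`.

## References

* [Shioda1979PJA] T. Shioda, The Hodge conjecture and the Tate conjecture for Fermat varieties,
  Proc. Japan Acad. 55A (1979) 111–114, §4 (text read).
* [Ran1980] Z. Ran, Cycles on Fermat hypersurfaces, Compositio Math. 42 (1980), §1 Prop. 1.7.
* [VoisinHodgeI2002] C. Voisin, Hodge Theory and Complex Algebraic Geometry I (2002), §7.3.2.
* [SerreGAGA1956] J.-P. Serre, GAGA, Ann. Inst. Fourier 6 (1956), §2 n°5.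
* [GrothendieckTopology1969] A. Grothendieck, Hodge's general conjecture is false for trivial
  reasons, Topology 8 (1969), §1 (the support filtration).
* [Katz2009] N. M. Katz, Another look at the Dwork family, Progr. Math. 270 (2009), §3.
-/

noncomputable section

open CategoryTheory AlgebraicGeometry MvPolynomial
open scoped Manifold ContDiff

namespace Literature.AlgebraicGeometry.HodgeTheory

open Literature.AlgebraicGeometry.Motives Literature.AlgebraicTopology.SingularHomology
  Literature.NumberTheory.Transcendental

/-! ### The diagonal symmetries form a group of automorphisms of `X_F` -/

section Group

attribute [local instance] MvPolynomial.gradedAlgebra Motives.ProjBaseChange.algebraBase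

variable {n : ℕ} (F : MvPolynomial (Fin (n + 2)) ℂ) {a b : Fin (n + 2) → ℂˣ}

/-- The grading of `ℂ[x₀, …, x_{n+1}]` by degree (local notation; `ℙⁿ⁺¹_ℂ = Proj 𝓐`). [folklore] -/
local notation "𝓐" => MvPolynomial.homogeneousSubmodule (Fin (n + 2)) ℂ

/-- The graded substitution `σ_a : xᵢ ↦ aᵢ xᵢ` of `DiagonalSymmetry`, abbreviated. [folklore] -/
abbrev diagonalSubstGraded (a : Fin (n + 2) → ℂˣ) : 𝓐 →+*ᵍ 𝓐 :=
  ProjectiveSpace.substGraded (diagonalSubst a) (isHomogeneous_diagonalSubst a)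

/-- `σ_a` moves the irrelevant ideal onto itself (the hypothesis of Mathlib's `Proj.map`). [folklore] -/
theorem irrelevant_le_map_diagonalSubstGraded (a : Fin (n + 2) → ℂˣ) :
    HomogeneousIdeal.irrelevant 𝓐 ≤ (HomogeneousIdeal.irrelevant 𝓐).map (diagonalSubstGraded a) :=
  ProjectiveSpace.irrelevant_le_map_substGraded _ _ _ (isHomogeneous_diagonalSubst a⁻¹)
    (aeval_diagonalSubst_aeval_diagonalSubst_inv a)

/-- The underlying morphism of `[z] ↦ [a • z]` is Mathlib's `Proj.map σ_a` (`rfl`). [folklore] -/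
theorem diagonalProjMap_left_eq (a : Fin (n + 2) → ℂˣ) :
    (diagonalProjMap (n := n) a).left =
      (Proj.map (diagonalSubstGraded a) (irrelevant_le_map_diagonalSubstGraded a) : Proj 𝓐 ⟶ Proj 𝓐) :=
  rfl

/-- `σ_{ab} = σ_a ∘ σ_b` as graded ring endomorphisms of `ℂ[x₀, …, x_{n+1}]`. [folklore] -/
theorem diagonalSubstGraded_mul (a b : Fin (n + 2) → ℂˣ) :
    diagonalSubstGraded (n := n) (a * b) = (diagonalSubstGraded a).comp (diagonalSubstGraded b) := by
  ext p : 1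
  change aeval (diagonalSubst (a * b)) p = aeval (diagonalSubst a) (aeval (diagonalSubst b) p)
  rw [aeval_diagonalSubst_aeval_diagonalSubst]

/-- `σ_1 = id` as a graded ring endomorphism. [folklore] -/
theorem diagonalSubstGraded_one : diagonalSubstGraded (n := n) 1 = GradedRingHom.id 𝓐 := by
  ext p : 1
  change aeval (diagonalSubst (1 : Fin (n + 2) → ℂˣ)) p = p
  rw [aeval_diagonalSubst_one]

/-- **`[z] ↦ [(ab) • z]` is `[z] ↦ [a • z]` followed by `[z] ↦ [b • z]`** on `ℙⁿ⁺¹_ℂ` (underlying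
schemes; Mathlib `Proj.map_comp`). [cite: Hartshorne1977, II Example 7.1.1] -/
theorem diagonalProjMap_left_mul (a b : Fin (n + 2) → ℂˣ) :
    (diagonalProjMap (n := n) (a * b)).left = (diagonalProjMap a).left ≫ (diagonalProjMap b).left := by
  show (Proj.map (diagonalSubstGraded (a * b)) (irrelevant_le_map_diagonalSubstGraded (a * b)) : Proj 𝓐 ⟶ Proj 𝓐) =
    Proj.map (diagonalSubstGraded a) (irrelevant_le_map_diagonalSubstGraded a) ≫
      Proj.map (diagonalSubstGraded b) (irrelevant_le_map_diagonalSubstGraded b)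
  rw [← Proj.map_comp]
  congr 1
  exact diagonalSubstGraded_mul a b

/-- `[z] ↦ [1 • z]` is the identity of `ℙⁿ⁺¹_ℂ` (Mathlib `Proj.map_id`). [cite: Hartshorne1977, II Example 7.1.1] -/
theorem diagonalProjMap_left_one :
    (diagonalProjMap (n := n) (1 : Fin (n + 2) → ℂˣ)).left = 𝟙 _ := by
  show (Proj.map (diagonalSubstGraded 1) (irrelevant_le_map_diagonalSubstGraded 1) : Proj 𝓐 ⟶ Proj 𝓐) = 𝟙 (Proj 𝓐)
  convert Proj.map_id (𝒜 := 𝓐) using 2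
  exact diagonalSubstGraded_one

/-- **`g_{ab} = g_a ≫ g_b`** on the hypersurface `X_F` (underlying schemes): both sides agree after
the closed immersion `X_F ↪ ℙⁿ⁺¹`, a monomorphism. [cite: Katz2009, §3] -/
theorem diagonalAut_left_mul (ha : a ∈ diagonalStabilizer F) (hb : b ∈ diagonalStabilizer F) :
    (diagonalAut F (mul_mem ha hb)).left = (diagonalAut F ha).left ≫ (diagonalAut F hb).left := by
  rw [← cancel_mono (SmoothHypersurface.hypersurfaceι F).left, diagonalAut_left_comp_ι,
    diagonalProjMap_left_mul, Category.assoc, diagonalAut_left_comp_ι, diagonalAut_left_comp_ι_assoc]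

/-- **`g_1 = 𝟙`** on `X_F` (underlying schemes). [cite: Katz2009, §3] -/
theorem diagonalAut_left_one :
    (diagonalAut F (one_mem (diagonalStabilizer F))).left = 𝟙 _ := by
  rw [← cancel_mono (SmoothHypersurface.hypersurfaceι F).left, diagonalAut_left_comp_ι,
    diagonalProjMap_left_one, Category.id_comp, Category.comp_id]

/-- `g_a` and `g_{a⁻¹}` are mutually inverse (underlying schemes). [cite: Katz2009, §3] -/
theorem diagonalAut_left_comp_inv (ha : a ∈ diagonalStabilizer F) :
    (diagonalAut F ha).left ≫ (diagonalAut F (inv_mem ha)).left = 𝟙 _ := by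
  rw [← diagonalAut_left_mul]
  have h : diagonalAut F (mul_mem ha (inv_mem ha)) = diagonalAut F (one_mem (diagonalStabilizer F)) := by
    congr 1; exact mul_inv_cancel a
  rw [h, diagonalAut_left_one]

/-- `g_{a⁻¹}` and `g_a` are mutually inverse (underlying schemes). [cite: Katz2009, §3] -/
theorem diagonalAut_left_inv_comp (ha : a ∈ diagonalStabilizer F) :
    (diagonalAut F (inv_mem ha)).left ≫ (diagonalAut F ha).left = 𝟙 _ := by
  rw [← diagonalAut_left_mul]
  have h : diagonalAut F (mul_mem (inv_mem ha) ha) = diagonalAut F (one_mem (diagonalStabilizer F)) := by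
    congr 1; exact inv_mul_cancel a
  rw [h, diagonalAut_left_one]

/-- **`g_a` is an automorphism of the scheme `X_F`**, with inverse `g_{a⁻¹}`. [cite: Katz2009, §3] -/
def diagonalAutIso (ha : a ∈ diagonalStabilizer F) :
    (SmoothHypersurface.hypersurface F).left ≅ (SmoothHypersurface.hypersurface F).left where
  hom := (diagonalAut F ha).left
  inv := (diagonalAut F (inv_mem ha)).left
  hom_inv_id := diagonalAut_left_comp_inv F ha
  inv_hom_id := diagonalAut_left_inv_comp F ha

/-- `g_a` is an isomorphism of schemes. [cite: Katz2009, §3] -/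
instance isIso_diagonalAut_left (ha : a ∈ diagonalStabilizer F) : IsIso (diagonalAut F ha).left :=
  (diagonalAutIso F ha).isIso_hom

end Group

/-! ### `g_a^*` and `π_χ` preserve algebraic classes -/

section Algebraic

variable {n : ℕ} (F : MvPolynomial (Fin (n + 2)) ℂ) {G : Subgroup (Fin (n + 2) → ℂˣ)} {a : Fin (n + 2) → ℂˣ}

/-- **`g_a^*` preserves algebraic classes**: for `X_F` smooth projective (of dimension `d`) and
`a ∈ diagonalStabilizer F`, `g_a^*(Nᵖ H²ᵖ(X_F(ℂ); ℂ)) ⊆ Nᵖ H²ᵖ(X_F(ℂ); ℂ)` — `g_a` is an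
isomorphism, hence flat, and flat pull-back respects the support filtration
(`map_mem_algebraicClasses_of_flat`). [cite: Shioda1979PJA, §4] [cite: GrothendieckTopology1969, §1] -/
theorem map_diagonalMap_mem_algebraicClasses {d : ℕ} (hX : IsSmoothProjective d (SmoothHypersurface.hypersurface F))
    (ha : a ∈ diagonalStabilizer F) {p : ℕ} {c : complexBetti (SmoothHypersurface.hypersurface F) (2 * p)}
    (hc : c ∈ algebraicClasses (SmoothHypersurface.hypersurface F) p) :
    singularCohomology.map ℂ ℂ (diagonalMap F ha) (2 * p) c ∈ algebraicClasses (SmoothHypersurface.hypersurface F) p := by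
  haveI : IsLocallyNoetherian (SmoothHypersurface.hypersurface F).left :=
    Motives.IsSmoothProjective.isLocallyNoetherian_holds hX
  exact map_mem_algebraicClasses_of_flat (diagonalAut F ha) hc

variable [Fintype G] (hG : G ≤ diagonalStabilizer F) (χ : G →* ℂˣ)

/-- **`π_χ` preserves algebraic classes** (a `ℂ`-linear combination of the `g_a^*`).
[cite: Shioda1979PJA, §4] -/
theorem eigenProjector_mem_algebraicClasses {d : ℕ} (hX : IsSmoothProjective d (SmoothHypersurface.hypersurface F))
    {p : ℕ} {c : complexBetti (SmoothHypersurface.hypersurface F) (2 * p)}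
    (hc : c ∈ algebraicClasses (SmoothHypersurface.hypersurface F) p) :
    eigenProjector F χ (2 * p) hG c ∈ algebraicClasses (SmoothHypersurface.hypersurface F) p := by
  rw [eigenProjector_apply]
  refine Submodule.smul_mem _ _ (Submodule.sum_mem _ fun a _ ↦ Submodule.smul_mem _ _ ?_)
  exact map_diagonalMap_mem_algebraicClasses F hX (hG a.2) hc

/-- **A one-dimensional eigenspace hit by a `π_χ`-stable subspace lies in it**: if `S` is a subspace
of `Hᵏ(X_F(ℂ); ℂ)` stable under `π_χ` (e.g. `algebraicClasses`, `eigenProjector_mem_algebraicClasses`),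
`dim V_χ ≤ 1`, and `π_χ c ≠ 0` for some `c ∈ S`, then `V_χ ≤ S` (so `V_χ` consists of algebraic
classes as soon as ONE algebraic class has a non-zero `χ`-component — the use made of the classes
of linear subspaces of the Fermat variety). [cite: Shioda1979PJA, §4] [cite: Ran1980, Thm. 4.9] -/
theorem diagonalCharacterEigenspace_le_of_finrank_le_one {k : ℕ}
    {S : Submodule ℂ (complexBetti (SmoothHypersurface.hypersurface F) k)}
    (hS : ∀ c ∈ S, eigenProjector F χ k hG c ∈ S)
    (hdim : Module.finrank ℂ (diagonalCharacterEigenspace F G χ k) ≤ 1)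
    [FiniteDimensional ℂ (diagonalCharacterEigenspace F G χ k)]
    {c : complexBetti (SmoothHypersurface.hypersurface F) k} (hcS : c ∈ S) (hc : eigenProjector F χ k hG c ≠ 0) :
    diagonalCharacterEigenspace F G χ k ≤ S := by
  intro x hx
  have hπc : eigenProjector F χ k hG c ∈ diagonalCharacterEigenspace F G χ k := eigenProjector_mem F hG c
  -- `V_χ` is the line spanned by `π_χ c`
  have hspan : (ℂ ∙ (⟨eigenProjector F χ k hG c, hπc⟩ : diagonalCharacterEigenspace F G χ k)) = ⊤ := by
    apply Submodule.eq_top_of_finrank_eq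
    refine le_antisymm (Submodule.finrank_le _) ?_
    rw [finrank_span_singleton]
    · exact hdim
    · exact fun h0 ↦ hc (congrArg Subtype.val h0)
  have hx' : (⟨x, hx⟩ : diagonalCharacterEigenspace F G χ k) ∈
      (ℂ ∙ (⟨eigenProjector F χ k hG c, hπc⟩ : diagonalCharacterEigenspace F G χ k)) := by
    rw [hspan]; exact Submodule.mem_top
  obtain ⟨t, ht⟩ := Submodule.mem_span_singleton.mp hx'
  have hxt : x = t • eigenProjector F χ k hG c := by
    have := congrArg Subtype.val ht
    simpa using this.symm
  rw [hxt]
  exact Submodule.smul_mem _ _ (hS c hcS)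

end Algebraic

/-! ### Endomorphisms preserve the Hodge types of a fixed Hodge model -/

section HodgeType

variable {n : ℕ} {X : Motives.SchemeOver ℂ}

/-- **An endomorphism of a smooth projective variety preserves the `(p, q)`-classes of every FIXED
Hodge model.** For `X` smooth projective of dimension `n`, `g : X ⟶ X` over `ℂ`, a Hodge model `A`
of `X` and `c ∈ Hᵏ(X(ℂ); ℂ)` with `A.pullback c ∈ A.hodgePQ k p q`, also
`A.pullback (g^* c) ∈ A.hodgePQ k p q`: writing `A.pullback c = e(w)` with `w ∈ H^{p,q}_dR(X^an)` and
`e = A.deRham`, one has `A.pullback (g^* c) = (g^an)^* e(w) = e((g^an)^*_dR w)` by naturality of `e`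
along the real-`C^∞` self-map `g^an` of `X^an` (a manifold charted on `A.model`), and
`(g^an)^*_dR w ∈ H^{p,q}_dR` because `g^an` is holomorphic (Voisin I §7.3.2; Serre GAGA §2 n°5). Source
and target model coincide, so no comparison of different models is involved.
[cite: VoisinHodgeI2002, §7.3.2] [cite: SerreGAGA1956, §2 n°5 (fonctorialité de X^h)] -/
theorem HodgeModel.pullback_map_mem_hodgePQ_of_endomorphism (A : HodgeModel n X)
    (hX : Motives.IsSmoothProjective n X) (g : X ⟶ X) {k p q : ℕ}
    {c : singularCohomology ℂ ℂ (Motives.ComplexPoints X) k} (hc : A.pullback k c ∈ A.hodgePQ k p q) :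
    A.pullback k (singularCohomology.map ℂ ℂ (Motives.AlgPoints.mapContinuous (L := ℂ) g) k c) ∈
      A.hodgePQ k p q := by
  obtain ⟨w, hw, hwc⟩ := Submodule.mem_map.1 hc
  rw [LinearEquiv.coe_toLinearMap] at hwc
  have hfan : ContMDiff 𝓘(ℝ, A.model) 𝓘(ℝ, A.model) ∞ (HodgeModel.anMap A A g) :=
    HodgeModel.contMDiff_anMap A A g hX hX
  have hfan' : MDifferentiable 𝓘(ℂ, A.model) 𝓘(ℂ, A.model) (HodgeModel.anMap A A g) :=
    HodgeModel.mdifferentiable_anMap A A g hX hX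
  rw [← HodgeModel.map_anMap_pullback, ← hwc]
  refine Submodule.mem_map.2 ⟨complexDeRhamCohomology.map A.model hfan k w, map_mem_hodgePQ hfan hfan' hw, ?_⟩
  rw [LinearEquiv.coe_toLinearMap]
  exact A.deRham_isNatural A.carrier A.carrier (HodgeModel.anMap A A g) hfan k w

/-- `∃`-model form: an endomorphism preserves Hodge types (`IsOfHodgeType`).
[cite: VoisinHodgeI2002, §7.3.2] -/
theorem IsOfHodgeType.map_endomorphism (hX : Motives.IsSmoothProjective n X) (g : X ⟶ X) {k p q : ℕ}
    {c : singularCohomology ℂ ℂ (Motives.ComplexPoints X) k} (hc : IsOfHodgeType n X k p q c) :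
    IsOfHodgeType n X k p q (singularCohomology.map ℂ ℂ (Motives.AlgPoints.mapContinuous (L := ℂ) g) k c) := by
  obtain ⟨A, hA⟩ := hc
  exact ⟨A, A.pullback_map_mem_hodgePQ_of_endomorphism hX g hA⟩

variable (F : MvPolynomial (Fin (n + 2)) ℂ) {G : Subgroup (Fin (n + 2) → ℂˣ)} {a : Fin (n + 2) → ℂˣ}

/-- **`g_a^*` preserves the `(p, q)`-classes of every fixed Hodge model of `X_F`** (`X_F` smooth
projective of dimension `n`). [cite: Shioda1979PJA, §4] [cite: VoisinHodgeI2002, §7.3.2] -/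
theorem HodgeModel.pullback_diagonalMap_mem_hodgePQ (A : HodgeModel n (SmoothHypersurface.hypersurface F))
    (hX : IsSmoothProjective n (SmoothHypersurface.hypersurface F)) (ha : a ∈ diagonalStabilizer F) {k p q : ℕ}
    {c : complexBetti (SmoothHypersurface.hypersurface F) k} (hc : A.pullback k c ∈ A.hodgePQ k p q) :
    A.pullback k (singularCohomology.map ℂ ℂ (diagonalMap F ha) k c) ∈ A.hodgePQ k p q :=
  A.pullback_map_mem_hodgePQ_of_endomorphism hX (diagonalAut F ha) hc

variable [Fintype G] (hG : G ≤ diagonalStabilizer F) (χ : G →* ℂˣ)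

/-- **`π_χ` preserves the `(p, q)`-classes of every fixed Hodge model of `X_F`** (the classes `c`
with `A.pullback c ∈ A.hodgePQ k p q` form a subspace stable under the `g_a^*`).
[cite: Shioda1979PJA, §4] -/
theorem HodgeModel.pullback_eigenProjector_mem_hodgePQ (A : HodgeModel n (SmoothHypersurface.hypersurface F))
    (hX : IsSmoothProjective n (SmoothHypersurface.hypersurface F)) {k p q : ℕ}
    {c : complexBetti (SmoothHypersurface.hypersurface F) k} (hc : A.pullback k c ∈ A.hodgePQ k p q) :
    A.pullback k (eigenProjector F χ k hG c) ∈ A.hodgePQ k p q := by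
  have key : eigenProjector F χ k hG c ∈ (A.hodgePQ k p q).comap (A.pullback k).hom := by
    rw [eigenProjector_apply]
    refine Submodule.smul_mem _ _ (Submodule.sum_mem _ fun a _ ↦ Submodule.smul_mem _ _ ?_)
    exact A.pullback_diagonalMap_mem_hodgePQ F hX (hG a.2) hc
  exact key

/-- `∃`-model form: `g_a^*` preserves Hodge types. [cite: Shioda1979PJA, §4] -/
theorem IsOfHodgeType.diagonalMap (hX : IsSmoothProjective n (SmoothHypersurface.hypersurface F))
    (ha : a ∈ diagonalStabilizer F) {k p q : ℕ} {c : complexBetti (SmoothHypersurface.hypersurface F) k}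
    (hc : IsOfHodgeType n (SmoothHypersurface.hypersurface F) k p q c) :
    IsOfHodgeType n (SmoothHypersurface.hypersurface F) k p q (singularCohomology.map ℂ ℂ (diagonalMap F ha) k c) :=
  hc.map_endomorphism hX (diagonalAut F ha)

/-- `∃`-model form: `π_χ` preserves Hodge types. [cite: Shioda1979PJA, §4] -/
theorem IsOfHodgeType.eigenProjector (hX : IsSmoothProjective n (SmoothHypersurface.hypersurface F))
    {k p q : ℕ} {c : complexBetti (SmoothHypersurface.hypersurface F) k}
    (hc : IsOfHodgeType n (SmoothHypersurface.hypersurface F) k p q c) :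
    IsOfHodgeType n (SmoothHypersurface.hypersurface F) k p q (eigenProjector F χ k hG c) := by
  obtain ⟨A, hA⟩ := hc
  exact ⟨A, A.pullback_eigenProjector_mem_hodgePQ F hG χ hX hA⟩

end HodgeType

end Literature.AlgebraicGeometry.HodgeTheory

end
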